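import Summits.Schanuel.Schanuel.Theorems.ZilberEacStripEscapeSeq
import Summits.Schanuel.Schanuel.Theorems.ZilberEacFibreCurveZeros
import HarnessLib

/-!
# Logarithmic strips, V: zeros of `P(z, e^z)` along a GIVEN upper edge and root, with the
# second-order position `Re z = μ log(Im z) + log|θ| + o(1)`

HONEST FRAMING.  Cell `pub-schanuel` (Zilber's Exponential-Algebraic Closedness, case ladder;
host summit Schanuel), seat 2, gen 18.  Over a graph base `x₁ = p(x₀)` (`deg p = d ≥ 2`) the fibre
curves `P(x₀, y₀) = 0` with `Re(lc(p)·i^d) = 0` (HANDOFF O65) are NOT decided by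
`unprojectedDense_fibreCurveSurface`: along the zeros `z_k = i n_k + O(log n_k)` of `P(z, e^z)` the
top-order term `Re(lc(p)(i n_k)^d)` vanishes and `Re p(z_k)` is governed by the SECOND-order term
`(dτ Re z_k + σ) n_k^{d-1}` (`τ = Re(lc(p) i^{d-1})`, `σ = Re(a_{d-1} i^{d-1})`), so the position of
`Re z_k` must be known up to `o(1)`.  This file supplies the zeros with that information: for every
upper supporting line `v₀ + μ v₁ ≤ κ` of the support of `P` (points `(v₁, v₀) = (y-degree,
x-degree)`) and every nonzero root `θ` of the edge polynomial `Q_μ(y) = Σ_{v₀ + μv₁ = κ} c_v y^{v₁}`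
(assumed nonzero), there are zeros `z_m` of `P(z, e^z)` with `Im z_m → +∞` and
`Re z_m - μ log(Im z_m) → log|θ|` (`exists_fibreCurve_zeros_of_edge`: degree-one log-corrected
roots `z₀ - μL = 2πiN + log θ`, `e^{L} = z₀` (`exists_lineRoot_log_seq`), engine v4 with vanishing
radii (`exists_strip_zeros_seq`), and the bookkeeping `log‖z₀‖ - log(Im z) → 0`).  Growth and
density: `ZilberEacFibreCurveGrowthTwo`, `ZilberEacFibreCurveDegenerate`.  NOT Schanuel's
conjecture (neither used nor implied; EAC ⇏ SC); `EC(3,2)` stays OPEN; Mantova–Masser's density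
question (PLMS 2024, §1 p. 5) stays OPEN in general.
-/

noncomputable section

open Filter Topology Metric Set Complex
open Literature.ModelTheory.Zilber

set_option linter.dupNamespace false

namespace Summit.Schanuel.Schanuel.Theorems

/-! ## Part A. Two limits -/

/-- If `a_m → ∞` and `|a_m - b_m| ≤ C + D log a_m`, then `log b_m - log a_m → 0`. [folklore] -/
theorem tendsto_log_sub_log_of_abs_sub_le {a b : ℕ → ℝ} (ha : Tendsto a atTop atTop) {C D : ℝ}
    (hab : ∀ᶠ m in atTop, |a m - b m| ≤ C + D * Real.log (a m)) :
    Tendsto (fun m => Real.log (b m) - Real.log (a m)) atTop (𝓝 0) := by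
  -- `b_m / a_m → 1`
  have hquot : Tendsto (fun m => b m / a m) atTop (𝓝 1) := by
    have hlog : Tendsto (fun m => Real.log (a m) / a m) atTop (𝓝 0) :=
      Real.isLittleO_log_id_atTop.tendsto_div_nhds_zero.comp ha
    have hinv : Tendsto (fun m => (a m)⁻¹) atTop (𝓝 0) := tendsto_inv_atTop_zero.comp ha
    have hsmall : Tendsto (fun m => |C| * (a m)⁻¹ + D * (Real.log (a m) / a m)) atTop (𝓝 0) := by
      have := (hinv.const_mul |C|).add (hlog.const_mul D)
      simpa using this
    have hdiff : Tendsto (fun m => b m / a m - 1) atTop (𝓝 0) := by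
      refine squeeze_zero_norm' ?_ hsmall
      filter_upwards [hab, ha.eventually_ge_atTop 1] with m hm h1
      have ha0 : 0 < a m := by linarith
      rw [Real.norm_eq_abs, show b m / a m - 1 = (b m - a m) / a m by field_simp, abs_div,
        abs_of_pos ha0, div_le_iff₀ ha0]
      have hlog0 : 0 ≤ Real.log (a m) := Real.log_nonneg h1
      rw [abs_sub_comm] at hm
      have e : (|C| * (a m)⁻¹ + D * (Real.log (a m) / a m)) * a m = |C| + D * Real.log (a m) := by
        field_simp
      rw [e]
      exact hm.trans (by linarith [le_abs_self C])
    have := hdiff.add_const 1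
    simpa using this
  have hlog1 : Tendsto (fun m => Real.log (b m / a m)) atTop (𝓝 0) := by
    have := ((Real.continuousAt_log one_ne_zero).tendsto.comp hquot)
    rwa [Real.log_one] at this
  refine hlog1.congr' ?_
  have hbpos : ∀ᶠ m in atTop, 0 < b m / a m := hquot.eventually (eventually_gt_nhds one_pos)
  filter_upwards [ha.eventually_gt_atTop 0, hbpos] with m ha0 hq
  have hb0 : 0 < b m := by
    have := mul_pos hq ha0
    rwa [div_mul_cancel₀ _ ha0.ne'] at this
  rw [Real.log_div hb0.ne' ha0.ne']

/-- `2πN - |μ| log(2πN + c) - c' → ∞` along `N → ∞`: an affine function minus a logarithm.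
[folklore] -/
theorem tendsto_sub_log_affine {N : ℕ → ℝ} (hN : Tendsto N atTop atTop) (A c c' : ℝ) (hA : 0 ≤ A)
    (hc : 0 ≤ c) :
    Tendsto (fun m => 2 * Real.pi * N m - A * Real.log (2 * Real.pi * N m + c) - c') atTop atTop := by
  have h2π : Tendsto (fun m => 2 * Real.pi * N m + c) atTop atTop :=
    tendsto_atTop_add_const_right _ _ (hN.const_mul_atTop Real.two_pi_pos)
  -- eventually `log x ≤ x / (2(A+1))`
  have hlog : ∀ᶠ x : ℝ in atTop, Real.log x ≤ 1 / (2 * (A + 1)) * x := by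
    have h := Real.isLittleO_log_id_atTop.bound (show (0 : ℝ) < 1 / (2 * (A + 1)) by positivity)
    filter_upwards [h, eventually_ge_atTop (1 : ℝ)] with x hx hx1
    simp only [Real.norm_eq_abs, id] at hx
    rw [abs_of_nonneg (Real.log_nonneg hx1), abs_of_nonneg (by linarith : (0 : ℝ) ≤ x)] at hx
    exact hx
  have hev := h2π.eventually hlog
  have hlin : Tendsto (fun m => Real.pi * N m - (c / 2 + c')) atTop atTop :=
    tendsto_atTop_add_const_right _ _ (hN.const_mul_atTop Real.pi_pos)
  refine tendsto_atTop_mono' atTop ?_ hlin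
  filter_upwards [hev, hN.eventually_ge_atTop 0] with m hm hN0
  have h1 : A * Real.log (2 * Real.pi * N m + c) ≤ A * (1 / (2 * (A + 1)) * (2 * Real.pi * N m + c)) :=
    mul_le_mul_of_nonneg_left hm hA
  have h2 : A * (1 / (2 * (A + 1)) * (2 * Real.pi * N m + c)) ≤ 1 / 2 * (2 * Real.pi * N m + c) := by
    have hx0 : 0 ≤ 2 * Real.pi * N m + c := by have := Real.pi_pos; positivity
    rw [← mul_assoc]
    refine mul_le_mul_of_nonneg_right ?_ hx0
    rw [mul_one_div, div_le_iff₀ (by positivity)]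
    linarith
  linarith

/-! ## Part B. Zeros along a given upper edge and root -/

/-- **Zeros of `P(z, e^z)` along a given upper edge and root, with second-order position.**
Let `v₀ + μ v₁ ≤ κ` on the support of `P ∈ ℂ[x, y]` (an upper supporting line of the points
`(v₁, v₀)`), and let `θ ≠ 0` be a root of the (nonzero) edge polynomial
`Q_μ(y) = Σ_{v₀ + μ v₁ = κ} c_v y^{v₁}`.  Then there are `z_m` with `P(z_m, e^{z_m}) = 0`,
`Im z_m → +∞` and `Re z_m - μ log(Im z_m) → log|θ|`. (new) -/
theorem exists_fibreCurve_zeros_of_edge (P : MvPolynomial (Fin 2) ℂ) (μ κ : ℝ)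
    (hκ : ∀ v ∈ P.support, ((v 0 : ℕ) : ℝ) + μ * (v 1 : ℕ) ≤ κ) {θ : ℂ} (hθ0 : θ ≠ 0)
    (hθ : (∑ v ∈ P.support.filter (fun v : Fin 2 →₀ ℕ => ((v 0 : ℕ) : ℝ) + μ * (v 1 : ℕ) = κ),
        Polynomial.C (P.coeff v) * Polynomial.X ^ (v 1)).eval θ = 0)
    (hQ : (∑ v ∈ P.support.filter (fun v : Fin 2 →₀ ℕ => ((v 0 : ℕ) : ℝ) + μ * (v 1 : ℕ) = κ),
        Polynomial.C (P.coeff v) * Polynomial.X ^ (v 1)) ≠ 0) :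
    ∃ z : ℕ → ℂ, (∀ m, MvPolynomial.eval ![z m, exp (z m)] P = 0) ∧
      Tendsto (fun m => (z m).im) atTop atTop ∧
      Tendsto (fun m => (z m).re - μ * Real.log ((z m).im)) atTop (𝓝 (Real.log ‖θ‖)) := by
  classical
  -- coefficient polynomials and exponents, as in `exists_fibreCurve_zeros`
  set q : (Fin 2 →₀ ℕ) → Polynomial ℂ := fun v =>
    Polynomial.C (P.coeff v) * Polynomial.X ^ (v 0) with hq_def
  set e : (Fin 2 →₀ ℕ) → ℕ := fun v => v 1 with he_def
  have hq_deg : ∀ v ∈ P.support, (q v).natDegree = v 0 := fun v hv =>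
    Polynomial.natDegree_C_mul_X_pow _ _ (MvPolynomial.mem_support_iff.1 hv)
  have hq_lc : ∀ v, (q v).leadingCoeff = P.coeff v := fun v =>
    Polynomial.leadingCoeff_C_mul_X_pow _ _
  have hκ' : ∀ v ∈ P.support, ((q v).natDegree : ℝ) + μ * e v ≤ κ := fun v hv => by
    rw [hq_deg v hv]; exact hκ v hv
  have hfilt : P.support.filter (fun v => ((q v).natDegree : ℝ) + μ * e v = κ) =
      P.support.filter (fun v : Fin 2 →₀ ℕ => ((v 0 : ℕ) : ℝ) + μ * (v 1 : ℕ) = κ) := by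
    refine Finset.filter_congr fun v hv => ?_
    rw [hq_deg v hv]
  have hsum : (∑ v ∈ P.support.filter (fun v => ((q v).natDegree : ℝ) + μ * e v = κ),
      Polynomial.C (q v).leadingCoeff * Polynomial.X ^ (e v)) =
      ∑ v ∈ P.support.filter (fun v : Fin 2 →₀ ℕ => ((v 0 : ℕ) : ℝ) + μ * (v 1 : ℕ) = κ),
        Polynomial.C (P.coeff v) * Polynomial.X ^ (v 1) := by
    rw [hfilt]
    refine Finset.sum_congr rfl fun v _ => ?_
    rw [hq_lc]
  have hθ' : (∑ v ∈ P.support.filter (fun v => ((q v).natDegree : ℝ) + μ * e v = κ),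
      Polynomial.C (q v).leadingCoeff * Polynomial.X ^ (e v)).eval θ = 0 := by
    rw [hsum]; exact hθ
  have hQ' : (∑ v ∈ P.support.filter (fun v => ((q v).natDegree : ℝ) + μ * e v = κ),
      Polynomial.C (q v).leadingCoeff * Polynomial.X ^ (e v)) ≠ 0 := by
    rw [hsum]; exact hQ
  -- the corrected roots `z₀ - μL = 2πi(k + K₀ + 1) + log θ`
  set c₀ : ℂ := Complex.log θ with hc₀_def
  have hc₀ : exp c₀ = θ := Complex.exp_log hθ0
  have hc₀re : c₀.re = Real.log ‖θ‖ := Complex.log_re θ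
  obtain ⟨K₀, z₀, Lg, hroot⟩ := exists_lineRoot_log_seq 1 one_ne_zero 0 c₀ μ 1 (Or.inl rfl)
  have hLz : ∀ k, exp (Lg k) = z₀ k := fun k => (hroot k).1
  have hz₀eq : ∀ k, z₀ k = ((((k + K₀ + 1 : ℕ) : ℤ) * (1 : ℤ) : ℤ) : ℂ) * (2 * Real.pi * I) + c₀ +
      (μ : ℂ) * Lg k := by
    intro k; have := (hroot k).2.1; linear_combination this
  have hz₀θ : ∀ k, exp (1 * z₀ k + 0) = θ * exp ((μ : ℂ) * Lg k) := by
    intro k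
    rw [(hroot k).2.1, Complex.exp_add, Complex.exp_add, Complex.exp_int_mul_two_pi_mul_I,
      one_mul, hc₀]
  -- sizes
  set NN : ℕ → ℝ := fun k => 2 * Real.pi * (((k + K₀ : ℕ) : ℝ) + 1) with hNN
  have hw_hi : ∀ k, ‖((((k + K₀ + 1 : ℕ) : ℤ) * (1 : ℤ) : ℤ) : ℂ) * (2 * Real.pi * I) + c₀‖ ≤
      NN k + ‖c₀‖ := by
    intro k; have := (hroot k).2.2.2.2.2.2.2; simp only [sub_zero] at this; exact this
  have hw_lo : ∀ k, NN k - ‖c₀‖ ≤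
      ‖((((k + K₀ + 1 : ℕ) : ℤ) * (1 : ℤ) : ℤ) : ℂ) * (2 * Real.pi * I) + c₀‖ := by
    intro k; have := (hroot k).2.2.2.2.2.2.1; simp only [sub_zero] at this; exact this
  have hLn : ∀ k, ‖Lg k‖ ≤ Real.log (NN k + ‖c₀‖) + 4 := by
    intro k
    have h := (hroot k).2.2.2.2.1
    simp only [norm_one, div_one, sub_zero] at h
    have hpos : 0 < ‖((((k + K₀ + 1 : ℕ) : ℤ) * (1 : ℤ) : ℤ) : ℂ) * (2 * Real.pi * I) + c₀‖ := by
      have h1 := (hroot k).2.2.1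
      simp only [norm_one, sub_zero] at h1
      linarith
    exact h.trans (by linarith [Real.log_le_log hpos (hw_hi k)])
  have hNN_t : Tendsto NN atTop atTop := by
    have h := ((tendsto_natCast_add_atTop 1).comp (tendsto_add_atTop_nat K₀)).const_mul_atTop
      Real.two_pi_pos
    refine h.congr fun k => ?_
    simp only [hNN, Function.comp_apply, Nat.cast_add]
  have hz₀norm : Tendsto (fun k => ‖z₀ k‖) atTop atTop := by
    refine tendsto_atTop_mono (fun k => ?_)
      ((tendsto_atTop_add_const_right _ (-‖c₀‖) hNN_t).atTop_div_const (by norm_num : (0:ℝ) < 2))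
    have h := (hroot k).2.2.2.2.2.1
    have h' := hw_lo k
    simp only [norm_one, div_one, sub_zero] at h
    linarith
  -- the imaginary and real parts of the corrected roots
  have hz₀eq' : ∀ k, z₀ k = ((NN k : ℝ) : ℂ) * I + c₀ + (μ : ℂ) * Lg k := by
    intro k
    rw [hz₀eq k]
    simp only [hNN]
    push_cast
    ring
  have hIm_z₀ : ∀ k, (z₀ k).im = NN k + c₀.im + μ * (Lg k).im := by
    intro k
    rw [hz₀eq' k]
    simp
  have hRe_z₀ : ∀ k, (z₀ k).re = Real.log ‖θ‖ + μ * Real.log ‖z₀ k‖ := by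
    intro k
    rw [← re_eq_log_norm_of_exp_eq (hLz k), ← hc₀re, hz₀eq' k]
    simp
  -- engine v4 with `E = 0` and vanishing radii
  obtain ⟨kk, u, hkk, hu1, -, hu0⟩ := exists_strip_zeros_seq (1 : ℂ) 0 one_ne_zero P.support q e
    μ κ hκ' hθ0 hθ' hQ' z₀ Lg hLz hz₀θ hz₀norm (fun _ => 0) (differentiable_const _)
    (fun η hη => Filter.Eventually.of_forall fun k u _ => by rw [norm_zero]; positivity)
  have hkk_t : Tendsto kk atTop atTop := tendsto_of_le_self hkk
  have hu_t : Tendsto (fun m => ‖u m‖) atTop (𝓝 0) := by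
    refine squeeze_zero (fun m => norm_nonneg _) (fun m => (hu1 m).le) ?_
    exact tendsto_one_div_add_atTop_nhds_zero_nat
  -- the zeros
  set z : ℕ → ℂ := fun m => z₀ (kk m) + u m with hz_def
  have hzero : ∀ m, MvPolynomial.eval ![z m, exp (z m)] P = 0 := by
    intro m
    rw [eval₂_exp_eq_sum]
    have := hu0 m
    simp only [hq_def, he_def, div_one, add_zero] at this
    simpa [hz_def] using this
  -- `Im z_m → ∞`
  have hIm_lo : ∀ m, NN (kk m) - ‖c₀‖ - |μ| * (Real.log (NN (kk m) + ‖c₀‖) + 4) - 1 ≤ (z m).im := by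
    intro m
    have e1 : (z m).im = NN (kk m) + c₀.im + μ * (Lg (kk m)).im + (u m).im := by
      simp only [hz_def, Complex.add_im, hIm_z₀]
    rw [e1]
    have h1 : |c₀.im| ≤ ‖c₀‖ := Complex.abs_im_le_norm c₀
    have h2 : |(Lg (kk m)).im| ≤ ‖Lg (kk m)‖ := Complex.abs_im_le_norm _
    have h3 : |(u m).im| ≤ ‖u m‖ := Complex.abs_im_le_norm _
    have h4 : ‖u m‖ ≤ 1 := by
      have := (hu1 m).le
      have h5 : 1 / ((m : ℝ) + 1) ≤ 1 := by
        rw [div_le_one (by positivity)]; have : (0:ℝ) ≤ m := Nat.cast_nonneg m; linarith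
      linarith
    have h6 : |μ * (Lg (kk m)).im| ≤ |μ| * (Real.log (NN (kk m) + ‖c₀‖) + 4) := by
      rw [abs_mul]
      exact mul_le_mul_of_nonneg_left (h2.trans (hLn _)) (abs_nonneg μ)
    have := neg_abs_le (c₀.im)
    have := neg_abs_le ((u m).im)
    have := neg_abs_le (μ * (Lg (kk m)).im)
    linarith
  have hIm_t : Tendsto (fun m => (z m).im) atTop atTop := by
    have hN : Tendsto (fun m => ((kk m + K₀ : ℕ) : ℝ) + 1) atTop atTop :=
      (tendsto_natCast_add_atTop 1).comp ((tendsto_add_atTop_nat K₀).comp hkk_t) |>.congr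
        fun m => by simp only [Function.comp_apply, Nat.cast_add]
    have h := tendsto_sub_log_affine hN |μ| ‖c₀‖ (‖c₀‖ + 4 * |μ| + 1) (abs_nonneg μ)
      (norm_nonneg c₀)
    refine tendsto_atTop_mono (fun m => ?_) h
    have := hIm_lo m
    simp only [hNN] at this ⊢
    linarith
  refine ⟨z, hzero, hIm_t, ?_⟩
  -- `Re z_m - μ log(Im z_m) → log|θ|`
  have hRe : ∀ m, (z m).re - μ * Real.log ((z m).im) - Real.log ‖θ‖ =
      μ * (Real.log ‖z₀ (kk m)‖ - Real.log ((z m).im)) + (u m).re := by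
    intro m
    simp only [hz_def, Complex.add_re, hRe_z₀]
    ring
  -- `log ‖z₀(k_m)‖ - log (Im z_m) → 0`
  have ha : Tendsto (fun m => ‖z₀ (kk m)‖) atTop atTop := hz₀norm.comp hkk_t
  have hlogdiff : Tendsto (fun m => Real.log ((z m).im) - Real.log ‖z₀ (kk m)‖) atTop (𝓝 0) := by
    refine tendsto_log_sub_log_of_abs_sub_le ha (C := |Real.log ‖θ‖| + 3) (D := |μ|) ?_
    filter_upwards [ha.eventually_ge_atTop 1, hIm_t.eventually_ge_atTop 0] with m h1 hIm0
    -- `‖z₀‖ - Im z₀ ≤ |Re z₀|` since `Im z₀ ≥ 0`... we compare `‖z₀‖` with `Im z = Im z₀ + Im u`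
    have hzIm : (z m).im = (z₀ (kk m)).im + (u m).im := by simp only [hz_def, Complex.add_im]
    have hu1' : ‖u m‖ ≤ 1 := by
      have := (hu1 m).le
      have h5 : 1 / ((m : ℝ) + 1) ≤ 1 := by
        rw [div_le_one (by positivity)]; have : (0:ℝ) ≤ m := Nat.cast_nonneg m; linarith
      linarith
    have hui : |(u m).im| ≤ 1 := (Complex.abs_im_le_norm _).trans hu1'
    have hIm_le : (z₀ (kk m)).im ≤ ‖z₀ (kk m)‖ := (le_abs_self _).trans (Complex.abs_im_le_norm _)
    -- `‖z₀‖ ≤ |Re z₀| + |Im z₀|` and `Im z₀ ≥ -1`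
    have hnorm_le : ‖z₀ (kk m)‖ ≤ |(z₀ (kk m)).re| + |(z₀ (kk m)).im| := Complex.norm_le_abs_re_add_abs_im _
    have hRe_abs : |(z₀ (kk m)).re| ≤ |Real.log ‖θ‖| + |μ| * Real.log ‖z₀ (kk m)‖ := by
      rw [hRe_z₀]
      have hl0 : 0 ≤ Real.log ‖z₀ (kk m)‖ := Real.log_nonneg h1
      calc |Real.log ‖θ‖ + μ * Real.log ‖z₀ (kk m)‖|
          ≤ |Real.log ‖θ‖| + |μ * Real.log ‖z₀ (kk m)‖| := abs_add_le _ _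
        _ = |Real.log ‖θ‖| + |μ| * Real.log ‖z₀ (kk m)‖ := by rw [abs_mul, abs_of_nonneg hl0]
    have hIm0' : 0 ≤ (z₀ (kk m)).im + (u m).im := by rw [← hzIm]; exact hIm0
    rw [hzIm]
    -- case analysis on the sign of `Im z₀` is avoided: `|Im z₀| ≤ Im z₀ + 2` as `Im z₀ ≥ -1`
    have hIm_ge : -1 ≤ (z₀ (kk m)).im := by have := le_abs_self ((u m).im); linarith
    have habsIm : |(z₀ (kk m)).im| ≤ (z₀ (kk m)).im + 2 := by
      rcases le_or_gt 0 (z₀ (kk m)).im with h | h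
      · rw [abs_of_nonneg h]; linarith
      · rw [abs_of_neg h]; linarith
    rw [abs_le]
    constructor
    · have := le_abs_self ((u m).im); linarith
    · have := neg_abs_le ((u m).im); linarith
  have hfinal : Tendsto (fun m => μ * (Real.log ‖z₀ (kk m)‖ - Real.log ((z m).im)) + (u m).re)
      atTop (𝓝 0) := by
    have h1 : Tendsto (fun m => μ * (Real.log ‖z₀ (kk m)‖ - Real.log ((z m).im))) atTop (𝓝 0) := by
      have := (hlogdiff.const_mul (-μ))
      simp only [mul_zero] at this
      refine this.congr fun m => ?_
      ring
    have h2 : Tendsto (fun m => (u m).re) atTop (𝓝 0) :=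
      squeeze_zero_norm (fun m => (Complex.abs_re_le_norm (u m))) hu_t
    simpa using h1.add h2
  have := hfinal.add_const (Real.log ‖θ‖)
  simp only [zero_add] at this
  refine this.congr fun m => ?_
  rw [← hRe m]
  ring

end Summit.Schanuel.Schanuel.Theorems
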